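import Summits.Ventures.AbcSig.Levels.N5216P1
import Summits.Ventures.AbcSig.Levels.N5216P2
import Summits.Ventures.AbcSig.Levels.N5216P3
import Summits.Ventures.AbcSig.Levels.N5216P4

/-!
# Venture AbcSig — GENERATED level file, level 5216 (AGGREGATOR of 4 part files)

HONEST FRAMING. As in the part files `N5216<part>.lean`, parts P1, P2, P3, P4 (a MIXED split: parts of
different size-splits of the same generator output landed in the tree at different times; every part carries the orbit
blocks of one contiguous run of orbits of the same certified level file `N5216.engine1.json`,
sha256 `6a00138cce207b26d8accf0bfa96b06dd550896a97c07c6230e8d7827022ebc6`): this file only concatenates the orbit lists and the part summaries into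
`level5216Orbits`, `level5216_wellformed`, `level5216_sieve` (the shapes the row templates consume). The split exists because the
tree's files are ≤ 400 lines and ≤ 200 000 bytes. Union of residual exponents ≥ 7: [7, 11, 41]; orbits not eliminable by
the sieve: none. No Diophantine statement is made here; no claim on ABC or any summit.
-/

namespace Summit.Ventures.AbcSig

/-- All newform orbits of level 5216 (concatenation of the parts, engine order). -/
def level5216Orbits : List OrbitData :=
  level5216OrbitsP1 ++ level5216OrbitsP2 ++ level5216OrbitsP3 ++ level5216OrbitsP4

/-- Every listed entry is at an odd prime not dividing 5216. -/
theorem level5216_wellformed :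
    ∀ o ∈ level5216Orbits, ∀ e ∈ o.coeffs, e.ell.Prime ∧ e.ell ≠ 2 ∧ ¬ e.ell ∣ 5216 := by
  unfold level5216Orbits
  exact List.forall_mem_append.2 ⟨List.forall_mem_append.2 ⟨List.forall_mem_append.2 ⟨level5216_wellformedP1, level5216_wellformedP2⟩, level5216_wellformedP3⟩, level5216_wellformedP4⟩

/-- **Level 5216 summary.** For a prime exponent `n ≥ 7`, every orbit of level 5216 is sieve-eliminated by the
kernel certificates of the part files, except that the row's predicate `X` is assumed for: orbit_5216_1 if n ∈ [7], orbit_5216_2 if n ∈ [7], orbit_5216_5 if n ∈ [41], orbit_5216_6 if n ∈ [41], orbit_5216_7 if n ∈ [7], orbit_5216_8 if n ∈ [7], orbit_5216_9 if n ∈ [11], orbit_5216_10 if n ∈ [11]. -/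
theorem level5216_sieve (n : ℕ) (hn : n.Prime) (hmin : 7 ≤ n) (X : OrbitData → Prop)
    (h_orbit_5216_1 : n ∈ ([7] : List ℕ) → X orbit_5216_1)
    (h_orbit_5216_2 : n ∈ ([7] : List ℕ) → X orbit_5216_2)
    (h_orbit_5216_5 : n ∈ ([41] : List ℕ) → X orbit_5216_5)
    (h_orbit_5216_6 : n ∈ ([41] : List ℕ) → X orbit_5216_6)
    (h_orbit_5216_7 : n ∈ ([7] : List ℕ) → X orbit_5216_7)
    (h_orbit_5216_8 : n ∈ ([7] : List ℕ) → X orbit_5216_8)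
    (h_orbit_5216_9 : n ∈ ([11] : List ℕ) → X orbit_5216_9)
    (h_orbit_5216_10 : n ∈ ([11] : List ℕ) → X orbit_5216_10) :
    ∀ o ∈ level5216Orbits, (∀ e ∈ o.coeffs, e.ell.Prime ∧ e.ell ≠ 2 ∧ ¬ e.ell ∣ 5216) ∧ (o.Eliminated bs04Allowed n ∨ X o) := by
  unfold level5216Orbits
  exact List.forall_mem_append.2 ⟨List.forall_mem_append.2 ⟨List.forall_mem_append.2 ⟨(level5216_sieveP1 n hn hmin X h_orbit_5216_1 h_orbit_5216_2 h_orbit_5216_5), (level5216_sieveP2 n hn hmin X h_orbit_5216_6 h_orbit_5216_7)⟩, (level5216_sieveP3 n hn hmin X h_orbit_5216_8 h_orbit_5216_9)⟩, (level5216_sieveP4 n hn hmin X h_orbit_5216_10)⟩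

end Summit.Ventures.AbcSig
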